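import Summits.ResolutionOfSingularities.ResolutionOfSingularities.Theorems.EquisingularLiftEquisingularLiftNatTowerRoundBDoublePrimeDefs
import Summits.ResolutionOfSingularities.ResolutionOfSingularities.Theorems.EquisingularLiftEquisingularLiftNatReachFourPointResolutionOfSubchainLift
import HarnessLib

/-!
# [OURS · L1 W4.5(b) · EL♮(3)] DEF-TOWER-B″-INST — the T23-A′ rung target `stub_elnat_defTowerBDoublePrimePointResolutionThree` (Reach := `ReachTowerBDoublePrime`) MODULO HSUB′(ReachTowerBDoublePrime)

res-L1-w45b-lead-2 g5 (text owner; T23-A″ registration prep (engine word 16d03a46d50c8ccd §4)): p611317 `stub_elnat_defTowerBPrimePointResolution_of_subchainLiftBPrime`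
VERBATIM with `ReachTowerBPrime ↦ ReachTowerBDoublePrime` (…NatTowerRoundBDoublePrimeDefs). OURS; pure logic over K5′ (`target_elnat_of_subchainResolution'`, Reach-generic);
NOT a statement of any manuscript; AI-written, weaker than expert review. No `sorry`; standard axioms; DEF-FREE. `--supports stmt-ResolutionOfSingularities-20148 --as helper`.
The supplier HSUB′(ReachTowerBPrime) is the widened engine `hsub_reachTowerBDoublePrime_of_fact` (to come) over the B″ driver `hsub_reachTowerBDoublePrime_of_invariant` (…NatTowerBDoublePrimeDriver).
-/

set_option linter.dupNamespace false
set_option linter.overlappingInstances false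
noncomputable section
open CategoryTheory CategoryTheory.Limits AlgebraicGeometry TopologicalSpace Topology
open MvPolynomial
open Literature.AlgebraicGeometry.Resolution
open AlgebraicGeometry.Scheme.IdealSheafData

namespace Summit.ResolutionOfSingularities.ResolutionOfSingularities.Cruxes.EquisingularLiftNat.Sections

/-- **DEF-TOWER-B″-INST**: the T23-A′ rung target `stub_elnat_defTowerBDoublePrimePointResolutionThree`'s conclusion shape (Reach := `ReachTowerBPrime`, any `n`) MODULO
HSUB′(ReachTowerBDoublePrime) — one application of K5′ `target_elnat_of_subchainResolution'`. [folklore; pure logic] [OURS · L1 W4.5b] -/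
theorem stub_elnat_defTowerBDoublePrimePointResolution_of_subchainLiftBDoublePrime (p : ℕ) : p.Prime → ∀ (k : Type) [Field k] [CharP k p] [IsAlgClosed k] (n : ℕ) (H : AlgebraicGeometry.Scheme.{0}) (ι : H ⟶ (Literature.AlgebraicGeometry.Motives.projectiveSpace n k).left), AlgebraicGeometry.IsClosedImmersion ι → AlgebraicGeometry.IsIntegral H → (∀ y : (Literature.AlgebraicGeometry.Motives.projectiveSpace n k).left, ∃ U : (Literature.AlgebraicGeometry.Motives.projectiveSpace n k).left.affineOpens, y ∈ (U : (Literature.AlgebraicGeometry.Motives.projectiveSpace n k).left.Opens) ∧ (ι.ker.ideal U).IsPrincipal) → (∀ (O : Type) [CommRing O] [IsDomain O] [IsDiscreteValuationRing O] [IsAdicComplete (IsLocalRing.maximalIdeal O) O] [IsAlgClosed (IsLocalRing.ResidueField O)] (θ : O →+* k), Function.Surjective θ → ∀ (P : AlgebraicGeometry.Scheme.{0}) (q : P ⟶ AlgebraicGeometry.Spec (.of O)) (Y : Set P) (Ch : ∀ X' : AlgebraicGeometry.Scheme.{0}, (X' ⟶ P) → Set X' → Prop), (∀ (X' X'' : AlgebraicGeometry.Scheme.{0})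 (σ' : X' ⟶ P) (S' : Set X') (C : X'.IdealSheafData) (τ : X'' ⟶ X'), Ch X' σ' S' → Literature.AlgebraicGeometry.Resolution.IsBlowup τ C → Literature.AlgebraicGeometry.Resolution.Scheme.IsRegular C.subscheme → AlgebraicGeometry.Flat (C.subschemeι ≫ σ' ≫ q) → σ' '' (C.support : Set X') ⊆ {y | ¬ IsGenericPoint y Y} → (C.support : Set X') ∩ (σ' ≫ q) ⁻¹' {IsLocalRing.closedPoint O} ⊆ S' → Ch X'' (τ ≫ σ') (closure (τ ⁻¹' (S' \ (C.support : Set X'))))) → (∀ (X' : AlgebraicGeometry.Scheme.{0}) (σ' : X' ⟶ P) (S' : Set X'), Ch X' σ' S' → Summit.ResolutionOfSingularities.ResolutionOfSingularities.Theses.EquisingularLift.Split.Chain P Y X' σ' S') → Y ⊆ q ⁻¹' {IsLocalRing.closedPoint O} → IsIrreducible Y → IsClosed Y → AlgebraicGeometry.IsIntegral P → IsLocallyNoetherian P → Literature.AlgebraicGeometry.Resolution.Scheme.IsRegular P → AlgebraicGeometry.IsProper q → AlgebraicGeometry.SmoothOfRelativeDimension n q → ∀ (X' : AlgebraicGeometry.Scheme.{0})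 (σ' : X' ⟶ P) (S' : Set X'), Ch X' σ' S' → AlgebraicGeometry.IsIntegral X' → IsLocallyNoetherian X' → Literature.AlgebraicGeometry.Resolution.Scheme.IsRegular X' → AlgebraicGeometry.IsDominant (σ' ≫ q) → ∀ (F₁ : AlgebraicGeometry.Scheme.{0}), AlgebraicGeometry.IsIntegral F₁ → ∀ (j : F₁ ⟶ X') (t : F₁ ⟶ AlgebraicGeometry.Spec (.of k)), IsPullback j t (σ' ≫ q) (AlgebraicGeometry.Spec.map (CommRingCat.ofHom θ)) → ∀ (T₁ : Set F₁), IsClosed T₁ → IsIrreducible T₁ → j '' T₁ = S' → ∀ (x : F₁) (hx : IsClosed ({x} : Set F₁)) (U : X'.Opens), AlgebraicGeometry.Smooth (U.ι ≫ σ' ≫ q) → ∀ (s : AlgebraicGeometry.Spec (.of O) ⟶ X'), s ≫ σ' ≫ q = 𝟙 _ → s (IsLocalRing.closedPoint O) ∈ U → s (IsLocalRing.closedPoint O) = j x → ringKrullDim (X'.presheaf.stalk (s (IsLocalRing.closedPoint O))) = ((n + 1 : ℕ) : WithBot ℕ∞) → IsRegularLocalRing (F₁.presheaf.stalk x) → (∀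 c ∈ (s.ker.support : Set X'), ¬ IsGenericPoint (σ' c) Y) → ∀ (X₁ : AlgebraicGeometry.Scheme.{0}) (τ₁ : X₁ ⟶ X'), Literature.AlgebraicGeometry.Resolution.IsBlowup τ₁ s.ker → AlgebraicGeometry.IsIntegral X₁ → IsLocallyNoetherian X₁ → Literature.AlgebraicGeometry.Resolution.Scheme.IsRegular X₁ → AlgebraicGeometry.IsDominant ((τ₁ ≫ σ') ≫ q) → ∀ (F₂ : AlgebraicGeometry.Scheme.{0}), AlgebraicGeometry.IsIntegral F₂ → ∀ (υ : F₂ ⟶ F₁), Literature.AlgebraicGeometry.Resolution.IsBlowup υ (AlgebraicGeometry.Scheme.IdealSheafData.vanishingIdeal (⟨{x}, hx⟩ : TopologicalSpace.Closeds F₁)) → ∀ (j₂ : F₂ ⟶ X₁) (t₂ : F₂ ⟶ AlgebraicGeometry.Spec (.of k)), IsPullback j₂ t₂ ((τ₁ ≫ σ') ≫ q) (AlgebraicGeometry.Spec.map (CommRingCat.ofHom θ)) → j₂ ≫ τ₁ = υ ≫ j → (s.ker.comap τ₁).comap j₂ = (AlgebraicGeometry.Scheme.IdealSheafData.vanishingIdeal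 (⟨{x}, hx⟩ : TopologicalSpace.Closeds F₁)).comap υ → IsIrreducible (closure (υ ⁻¹' (T₁ \ {x}))) → Ch X₁ (τ₁ ≫ σ') (j₂ '' closure (υ ⁻¹' (T₁ \ {x}))) → ∀ (F₉ : AlgebraicGeometry.Scheme.{0}) (β : F₉ ⟶ F₂) (T₉ : Set F₉), ReachTowerBDoublePrime F₁ F₂ υ x (closure (υ ⁻¹' (T₁ \ {x}))) F₉ β T₉ → ∃ (X₉ : AlgebraicGeometry.Scheme.{0}) (σ₉ : X₉ ⟶ P) (S₉ : Set X₉) (j₉ : F₉ ⟶ X₉) (t₉ : F₉ ⟶ AlgebraicGeometry.Spec (.of k)), Ch X₉ σ₉ S₉ ∧ AlgebraicGeometry.IsIntegral X₉ ∧ IsLocallyNoetherian X₉ ∧ Literature.AlgebraicGeometry.Resolution.Scheme.IsRegular X₉ ∧ AlgebraicGeometry.IsDominant (σ₉ ≫ q) ∧ IsPullback j₉ t₉ (σ₉ ≫ q) (AlgebraicGeometry.Spec.map (CommRingCat.ofHom θ)) ∧ j₉ '' T₉ = S₉ ∧ IsClosed T₉ ∧ IsIrreducible T₉ ∧ AlgebraicGeometry.IsIntegral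 F₉) → (∃ (F' : AlgebraicGeometry.Scheme.{0}) (ρ' : F' ⟶ (Literature.AlgebraicGeometry.Motives.projectiveSpace n k).left) (T' : Set F'), (∀ Q : (∀ F₁ : AlgebraicGeometry.Scheme.{0}, (F₁ ⟶ (Literature.AlgebraicGeometry.Motives.projectiveSpace n k).left) → Set F₁ → Prop), Q (Literature.AlgebraicGeometry.Motives.projectiveSpace n k).left (𝟙 (Literature.AlgebraicGeometry.Motives.projectiveSpace n k).left) (Set.range ι) → (∀ (F₁ F₂ : AlgebraicGeometry.Scheme.{0}) (ρ : F₁ ⟶ (Literature.AlgebraicGeometry.Motives.projectiveSpace n k).left) (T₁ : Set F₁) (x : ↥(AlgebraicGeometry.Scheme.IdealSheafData.vanishingIdeal (⟨closure T₁, isClosed_closure⟩ : TopologicalSpace.Closeds F₁)).subscheme) (υ : F₂ ⟶ F₁) (hx : IsClosed ({((AlgebraicGeometry.Scheme.IdealSheafData.vanishingIdeal (⟨closure T₁, isClosed_closure⟩ : TopologicalSpace.Closeds F₁)).subschemeι x : F₁)} : Set F₁)), Q F₁ ρ T₁ → ¬ IsRegularLocalRing ((AlgebraicGeometry.Scheme.IdealSheafData.vanishingIdeal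 (⟨closure T₁, isClosed_closure⟩ : TopologicalSpace.Closeds F₁)).subscheme.presheaf.stalk x) → IsRegularLocalRing (F₁.presheaf.stalk ((AlgebraicGeometry.Scheme.IdealSheafData.vanishingIdeal (⟨closure T₁, isClosed_closure⟩ : TopologicalSpace.Closeds F₁)).subschemeι x)) → Literature.AlgebraicGeometry.Resolution.IsBlowup υ (AlgebraicGeometry.Scheme.IdealSheafData.vanishingIdeal (⟨{((AlgebraicGeometry.Scheme.IdealSheafData.vanishingIdeal (⟨closure T₁, isClosed_closure⟩ : TopologicalSpace.Closeds F₁)).subschemeι x : F₁)}, hx⟩ : TopologicalSpace.Closeds F₁)) → Q F₂ (υ ≫ ρ) (closure (υ ⁻¹' (T₁ \ {((AlgebraicGeometry.Scheme.IdealSheafData.vanishingIdeal (⟨closure T₁, isClosed_closure⟩ : TopologicalSpace.Closeds F₁)).subschemeι x : F₁)}))) ∧ (∀ (F₉ : AlgebraicGeometry.Scheme.{0}) (β : F₉ ⟶ F₂) (T₉ : Set F₉), ReachTowerBDoublePrime F₁ F₂ υ ((AlgebraicGeometry.Scheme.IdealSheafData.vanishingIdeal (⟨closure T₁, isClosed_closure⟩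 : TopologicalSpace.Closeds F₁)).subschemeι x) (closure (υ ⁻¹' (T₁ \ {((AlgebraicGeometry.Scheme.IdealSheafData.vanishingIdeal (⟨closure T₁, isClosed_closure⟩ : TopologicalSpace.Closeds F₁)).subschemeι x : F₁)}))) F₉ β T₉ → Q F₉ ((β ≫ υ) ≫ ρ) T₉)) → Q F' ρ' T') ∧ Literature.AlgebraicGeometry.Resolution.Scheme.IsRegular (AlgebraicGeometry.Scheme.IdealSheafData.vanishingIdeal (⟨closure T', isClosed_closure⟩ : TopologicalSpace.Closeds F')).subscheme) → ∃ (O : Type) (_ : CommRing O) (_ : IsDomain O) (_ : IsDiscreteValuationRing O) (_ : CharZero O) (π : O →+* k), Function.Surjective π ∧ (letI := MvPolynomial.gradedAlgebra (σ := Fin (n + 1)) (R := O); letI := MvPolynomial.gradedAlgebra (σ := Fin (n + 1)) (R := k); ∀ (φ : MvPolynomial.homogeneousSubmodule (Fin (n + 1)) O →+*ᵍ MvPolynomial.homogeneousSubmodule (Fin (n + 1)) k) (hφ' : HomogeneousIdeal.irrelevant (MvPolynomial.homogeneousSubmodule (Fin (n + 1)) k) ≤ (HomogeneousIdeal.irrelevant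 (MvPolynomial.homogeneousSubmodule (Fin (n + 1)) O)).map φ), (∀ s, φ s = MvPolynomial.map π s) → ∀ Y : Set (AlgebraicGeometry.Proj (MvPolynomial.homogeneousSubmodule (Fin (n + 1)) O)), Y = Set.range (ι ≫ AlgebraicGeometry.Proj.map φ hφ' : H ⟶ AlgebraicGeometry.Proj (MvPolynomial.homogeneousSubmodule (Fin (n + 1)) O)) → ∃ (P' : AlgebraicGeometry.Scheme.{0}) (σ : P' ⟶ AlgebraicGeometry.Proj (MvPolynomial.homogeneousSubmodule (Fin (n + 1)) O)) (S' : Set P'), (∀ Q : (∀ X' : AlgebraicGeometry.Scheme.{0}, (X' ⟶ AlgebraicGeometry.Proj (MvPolynomial.homogeneousSubmodule (Fin (n + 1)) O)) → Set X' → Prop), Q (AlgebraicGeometry.Proj (MvPolynomial.homogeneousSubmodule (Fin (n + 1)) O)) (𝟙 _) Y → (∀ (X' X'' : AlgebraicGeometry.Scheme.{0}) (σ' : X' ⟶ AlgebraicGeometry.Proj (MvPolynomial.homogeneousSubmodule (Fin (n + 1)) O)) (Y' : Set X') (C : X'.IdealSheafData) (τ : X'' ⟶ X'), Q X' σ' Y'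 → Literature.AlgebraicGeometry.Resolution.IsBlowup τ C → Literature.AlgebraicGeometry.Resolution.Scheme.IsRegular C.subscheme → AlgebraicGeometry.Flat (C.subschemeι ≫ σ' ≫ AlgebraicGeometry.Proj.toSpecZero (MvPolynomial.homogeneousSubmodule (Fin (n + 1)) O) ≫ AlgebraicGeometry.Spec.map (CommRingCat.ofHom (algebraMap O (MvPolynomial.homogeneousSubmodule (Fin (n + 1)) O 0)))) → σ' '' (C.support : Set X') ⊆ {x | ¬ IsGenericPoint x Y} → (C.support : Set X') ∩ (σ' ≫ AlgebraicGeometry.Proj.toSpecZero (MvPolynomial.homogeneousSubmodule (Fin (n + 1)) O) ≫ AlgebraicGeometry.Spec.map (CommRingCat.ofHom (algebraMap O (MvPolynomial.homogeneousSubmodule (Fin (n + 1)) O 0)))) ⁻¹' {IsLocalRing.closedPoint O} ⊆ Y' → Q X'' (τ ≫ σ') (closure (τ ⁻¹' (Y' \ (C.support : Set X'))))) → Q P' σ S') ∧ Literature.AlgebraicGeometry.Resolution.Scheme.IsRegular (AlgebraicGeometry.Scheme.IdealSheafData.vanishingIdeal (⟨closure S', isClosed_closure⟩ : TopologicalSpace.Closeds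 P')).subscheme) := by
  intro hp k _ _ _ n H ι hι hH hloc HSUB hres
  exact target_elnat_of_subchainResolution' p hp k n H ι hι hH hloc ReachTowerBDoublePrime HSUB hres

end Summit.ResolutionOfSingularities.ResolutionOfSingularities.Cruxes.EquisingularLiftNat.Sections

end
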